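import Summits.QuantumFields.QCD.Theorems.QuarksAsStableActionStableActionBridgeStubMulInvolutionOp
import HarnessLib

/-!
# Stub `stub_sector_of_simple` of line `twisted_trace_transfer`
# for crux `QuarksAsStableAction.StableActionBridge` (item stmt-QuantumFields-9737)

This file proves the registered stub `stub_sector_of_simple` (sub-goal W6b of step E3 of the lead
skeleton of line `twisted_trace_transfer`, `--supports`): **an eigenvector of a SIMPLE level of a
sector-conserving kernel operator lives in ONE sector.**

Setting.  `(Y, ρ)` is a finite measure space with a measurable, bounded "mode number"
`nY : Y → ℕ`, `nY ≤ D`; `K` is a bounded strongly measurable kernel vanishing across sectors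
(`nY x ≠ nY y ⇒ K x y = 0`) and `A` the bounded operator on `L²(ρ; ℂ)` it represents a.e.  If
`A φ = μ φ`, `φ ≠ 0`, and every `ψ` with `A ψ = μ ψ` is a multiple of `φ`, then there is `n₀ ≤ D` with
`φ = 0` a.e. on `{nY ≠ n₀}`.  (In E3, `A` is the lattice-QCD transfer operator and `nY` the fermion
mode number; the vacuum-parity clause consumes this.)

## Proof

For each `m : ℕ` let `w_m := +1` on `{nY = m}` and `−1` elsewhere (measurable, `±1`-valued) and let
`F_m` be the multiplication involution of the landed stub `stub_mulInvolutionOp`.  The sector rule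
gives the intertwining `K(x,y) w_m(y) = w_m(x) K(x,y)` (both sides vanish unless `nY x = nY y`), so
`A F_m = F_m A` (4th clause of `stub_mulInvolutionOp`); hence `A (F_m φ) = μ F_m φ` and, by
simplicity, `F_m φ = c_m φ`, i.e. `w_m φ = c_m φ` a.e.  **Dichotomy:** if `c_m = 1` then `−φ = φ`,
so `φ = 0`, a.e. on `{nY ≠ m}`; if `c_m ≠ 1` then `(c_m − 1) φ = 0`, so `φ = 0`, a.e. on `{nY = m}`.
If no `m ≤ D` fell in the first case, `φ` would vanish a.e. on every `{nY = m}`, `m ≤ D`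
(`ae_all_iff`), i.e. a.e. (as `nY ≤ D`), so `φ = 0` in `L²` (`Lp.ext`) — contradicting `φ ≠ 0`.
(This replaces the trace-counting argument of the skeleton sketch by a direct support argument; no
inner products are needed.)

Pure theorem file (no definitions); helpers live in the sub-namespace `StubSectorOfSimple`.
Mathlib + the landed stub `stub_mulInvolutionOp` only. [folklore]
-/

noncomputable section

open MeasureTheory Filter
open scoped InnerProductSpace ComplexConjugate

namespace Summit.QuantumFields.QCD.Cruxes.StableActionBridge.TwistedTraceTransfer

namespace StubSectorOfSimple

variable {Y : Type} {nY : Y → ℕ}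

/-- The sector sign is `±1`-valued. [folklore] -/
theorem sectorSign_eq_or (m : ℕ) (y : Y) :
    (if nY y = m then (1 : ℝ) else -1) = 1 ∨ (if nY y = m then (1 : ℝ) else -1) = -1 := by
  by_cases h : nY y = m
  · exact Or.inl (if_pos h)
  · exact Or.inr (if_neg h)

/-- **Sector rule ⇒ intertwining.** A kernel vanishing across sectors intertwines every sector
sign: `K(x,y) w_m(y) = w_m(x) K(x,y)` (both sides vanish unless `nY x = nY y`). [folklore] -/
theorem kernel_mul_sectorSign {K : Y → Y → ℂ} (hKsec : ∀ x y, nY x ≠ nY y → K x y = 0) (m : ℕ)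
    (x y : Y) :
    K x y * ((if nY y = m then (1 : ℝ) else -1 : ℝ) : ℂ) =
      ((if nY x = m then (1 : ℝ) else -1 : ℝ) : ℂ) * K x y := by
  by_cases hxy : nY x = nY y
  · rw [hxy, mul_comm]
  · rw [hKsec x y hxy, zero_mul, mul_zero]

variable [MeasurableSpace Y] {ρ : Measure Y}

/-- The sector sign `w_m = +1` on `{nY = m}`, `−1` elsewhere, is measurable for measurable `nY`
(`Measurable.ite` on the preimage of a singleton). [folklore] -/
theorem measurable_sectorSign (hnY : Measurable nY) (m : ℕ) :
    Measurable fun y => if nY y = m then (1 : ℝ) else -1 :=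
  Measurable.ite (hnY (measurableSet_singleton m)) measurable_const measurable_const

/-- An operator `F` commuting with `A` maps a `μ`-eigenvector `φ` of a SIMPLE level of `A` to a
multiple of `φ` (`A (F φ) = F (A φ) = μ F φ`). [folklore] -/
theorem exists_apply_eq_smul {A F : Lp ℂ 2 ρ →L[ℂ] Lp ℂ 2 ρ} (hcomm : A * F = F * A)
    {φ : Lp ℂ 2 ρ} {μ : ℂ} (hAφ : A φ = μ • φ)
    (hsimple : ∀ ψ : Lp ℂ 2 ρ, A ψ = μ • ψ → ∃ c : ℂ, ψ = c • φ) :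
    ∃ c : ℂ, F φ = c • φ := by
  refine hsimple (F φ) ?_
  rw [← mul_apply_eq_comp A F φ, hcomm, mul_apply_eq_comp, hAφ, map_smul]

/-- **Sector dichotomy.** For the operator `A` of a bounded strongly measurable sector-conserving
kernel and a `μ`-eigenvector `φ` of a simple level, for every `m : ℕ` either `φ = 0` a.e. off the
sector `{nY = m}` or `φ = 0` a.e. on it: the sector involution `F_m` of `stub_mulInvolutionOp`
commutes with `A`, so `w_m φ = c φ` a.e. for a constant `c`; `c = 1` gives the first alternative,
`c ≠ 1` the second. [folklore] -/
theorem ae_sector_dichotomy [IsFiniteMeasure ρ] (hnY : Measurable nY) {K : Y → Y → ℂ} {C : ℝ}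
    (hK : StronglyMeasurable (Function.uncurry K)) (hKC : ∀ x y, ‖K x y‖ ≤ C)
    (hKsec : ∀ x y, nY x ≠ nY y → K x y = 0) {A : Lp ℂ 2 ρ →L[ℂ] Lp ℂ 2 ρ}
    (hA : ∀ φ : Lp ℂ 2 ρ, (A φ : Y → ℂ) =ᵐ[ρ] fun x => ∫ y, K x y * φ y ∂ρ)
    {φ : Lp ℂ 2 ρ} {μ : ℂ} (hAφ : A φ = μ • φ)
    (hsimple : ∀ ψ : Lp ℂ 2 ρ, A ψ = μ • ψ → ∃ c : ℂ, ψ = c • φ) (m : ℕ) :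
    (∀ᵐ y ∂ρ, nY y ≠ m → (φ : Y → ℂ) y = 0) ∨ (∀ᵐ y ∂ρ, nY y = m → (φ : Y → ℂ) y = 0) := by
  obtain ⟨F, hF, -, -, hFcomm, -⟩ := stub_mulInvolutionOp Y ρ
    (fun y => if nY y = m then (1 : ℝ) else -1) (measurable_sectorSign hnY m) (sectorSign_eq_or m)
  have hcomm : A * F = F * A := hFcomm K C hK hKC (kernel_mul_sectorSign hKsec m) A hA
  obtain ⟨c, hc⟩ := exists_apply_eq_smul hcomm hAφ hsimple
  have hae : ∀ᵐ y ∂ρ,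
      ((if nY y = m then (1 : ℝ) else -1 : ℝ) : ℂ) * (φ : Y → ℂ) y = c * (φ : Y → ℂ) y := by
    have h1 := hF φ
    rw [hc] at h1
    filter_upwards [h1, Lp.coeFn_smul c φ] with y hy hy'
    rw [← hy, hy', Pi.smul_apply, smul_eq_mul]
  by_cases hc1 : c = 1
  · refine Or.inl ?_
    filter_upwards [hae] with y hy hym
    rw [if_neg hym, hc1, Complex.ofReal_neg, Complex.ofReal_one] at hy
    linear_combination (-1 / 2 : ℂ) * hy
  · refine Or.inr ?_
    filter_upwards [hae] with y hy hym
    rw [if_pos hym, Complex.ofReal_one] at hy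
    have h0 : (c - 1) * (φ : Y → ℂ) y = 0 := by linear_combination -hy
    exact (mul_eq_zero.1 h0).resolve_left (sub_ne_zero.2 hc1)

end StubSectorOfSimple

/-- **Sub-goal W6b (registered stub `stub_sector_of_simple`; abstract): an eigenvector of a simple
level of a sector-conserving kernel operator lives in ONE sector.**  On a finite measure space with
a bounded measurable "mode number" `nY : Y → ℕ`, `nY ≤ D`, a bounded strongly measurable kernel
vanishing across sectors (`nY x ≠ nY y ⇒ K x y = 0`) and its operator `A`: if `A φ = μ φ`, `φ ≠ 0`,
and every `ψ` with `A ψ = μ ψ` is a multiple of `φ`, then `φ` vanishes a.e. off one sector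
`{nY = n₀}`, `n₀ ≤ D`.  Proof: by the sector dichotomy
(`StubSectorOfSimple.ae_sector_dichotomy`), if no `m ≤ D` worked then `φ = 0` a.e. on every sector
`{nY = m}`, `m ≤ D`, hence a.e. (`ae_all_iff`, `nY ≤ D`), so `φ = 0` (`Lp.ext`), absurd. [folklore] -/
theorem stub_sector_of_simple : ∀ (Y : Type) [MeasurableSpace Y] (ρ : Measure Y) [IsFiniteMeasure ρ] (nY : Y → ℕ) (D : ℕ),
    Measurable nY → (∀ y, nY y ≤ D) →
    ∀ (K : Y → Y → ℂ) (C : ℝ), StronglyMeasurable (Function.uncurry K) → (∀ x y, ‖K x y‖ ≤ C) →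
    (∀ x y, nY x ≠ nY y → K x y = 0) →
    ∀ A : Lp ℂ 2 ρ →L[ℂ] Lp ℂ 2 ρ, (∀ φ : Lp ℂ 2 ρ, (A φ : Y → ℂ) =ᵐ[ρ] fun x => ∫ y, K x y * φ y ∂ρ) →
    ∀ (φ : Lp ℂ 2 ρ) (μ : ℂ), φ ≠ 0 → A φ = μ • φ →
    (∀ ψ : Lp ℂ 2 ρ, A ψ = μ • ψ → ∃ c : ℂ, ψ = c • φ) →
    ∃ n₀ : ℕ, n₀ ≤ D ∧ ∀ᵐ y ∂ρ, nY y ≠ n₀ → (φ : Y → ℂ) y = 0 := by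
  intro Y _ ρ _ nY D hnY hD K C hK hKC hKsec A hA φ μ hφ hAφ hsimple
  by_contra hnot
  have hall : ∀ m : ℕ, ∀ᵐ y ∂ρ, m ≤ D → nY y = m → (φ : Y → ℂ) y = 0 := by
    intro m
    by_cases hm : m ≤ D
    · have h := (StubSectorOfSimple.ae_sector_dichotomy hnY hK hKC hKsec hA hAφ hsimple m).resolve_left
        fun h' => hnot ⟨m, hm, h'⟩
      exact h.mono fun y hy _ => hy
    · exact ae_of_all ρ fun y hm' => absurd hm' hm
  have hz : (φ : Y → ℂ) =ᵐ[ρ] 0 := by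
    filter_upwards [ae_all_iff.2 hall] with y hy
    exact hy (nY y) (hD y) rfl
  exact hφ (Lp.ext (hz.trans (Lp.coeFn_zero ℂ 2 ρ).symm))

end Summit.QuantumFields.QCD.Cruxes.StableActionBridge.TwistedTraceTransfer

end
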